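import Summits.QuantumFields.YangMills.Theorems.BalabanUVNodesN09OneBondParametricOpenness
import Summits.QuantumFields.YangMills.Theorems.BalabanUVNodesN09CentralWindowInverseContinuous
import Summits.QuantumFields.YangMills.Theorems.BalabanUVNodesN09LiftInvariance29AtRecord

/-!
# NODE N09 [B12] — THE BASE POINT IS INTERIOR TO THE CLOSED α-WINDOW OF RECORD, hence (O) for the image windows of the per-bond charts, unconditionally but for `hsolν` + numerics

Cell `pub-ymgap` (YM-PLAN Track A), width seat `pub-ymgap-dag-n09-w6` g4, FILE 8′ (INTENT-8 rescoped, bus I.38252); helper of K1⁹ `StabilityBRunRowsAtRecordR13SepCoPHV` =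
stmt-QuantumFields-27364 (`--supports`, `--as helper`, count-neutral).  [I] = [Balaban1987RG1] (CMP 109), [B7] = [Balaban1985Averaging] (CMP 98), [B11] = [Balaban1985Variational].

WHY.  dag-n09-w1 g6's `…N09OneBondParametricOpenness.hopen_domAlt_of_windowInterior_of_hsolν` proves the (O) socket of this seat's p632316
`…N09TowerBasePointSocketsOfOpenness.tower_hΦc∕hJpos_of_openness_of_hsolν_of_numerics` for ANY window family `Ω c U` MODULO ONE displayed input `hwin`: the graph
`{p | p.2 ∈ Ω c p.1}` is a neighbourhood of the base point `(V^{(j)}(V), V^{(j)}(V)(β c))`.  For the window family OF RECORD — the closed α-window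
`Ωα c U = {g | ∀ i, dist1 (fibreFamily U c (pre U c · g · post U c) i) ≤ α}` of p633472 ∕ dag-n09-w6 g3's per-bond charts (`T c U = (g ↦ Ū(U[β c ↦ g])(c)) '' Ωα c U`) — `hwin`
HOLDS: the window letters `(U, g) ↦ fibreFamily U c (pre U c · g · post U c) i` are jointly continuous (this seat's p631266 `continuous_centralWindowFamily`), at `g = U(β c)` they are
the loop letters `loopHol U c i` (`loopHol_update_centralBond_self`), and at the critical configuration `U = V^{(j)}(V)` those are `≤ (((d+2)L)²∕4)·(2εreg∕L²)` ([B7] Prop. 2 at the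
record, dag-n09-w1 g6's `loopHol_critCfgOfRecord_le`), which is `< α` under the STRICT chart guard.  So the STRICT window `{< α}` is an open set containing the base point and sits
inside `Ωα`.

WHAT IS PROVED (theorems only; 0 `def`, 0 `instance`, 0 `sorry`).
§1 `centralWindowGraph_mem_nhds_of_loopHol_lt` — generic torus `P`, `j+1 ≤ m+K`: STRICT loop letters `∀ i, dist1 (loopHol U₀ c i) < α` ⟹ `{p | ∀ i, dist1 (fibreFamily p.1 c (pre·p.2·post) i) ≤ α} ∈ 𝓝 (U₀, U₀(β c))`.
§2 `centralWindowGraph_mem_nhds_critCfg_of_ukExists` — AT THE RECORD (`j < K`, `UkExists … (j+1) εreg V`, Prop-2 numerics, STRICT guard `(((d+2)L)²∕4)·(2εreg∕L²) < α`): the same at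
   `(critCfgOfRecord F N ν K j V, (critCfgOfRecord F N ν K j V)(β c))`.
§3 ★★★ `image_centralWindow_mem_nhds_critCfg_of_ukExists` — (O) for the closed α-window of record, level-`j` solvability form: dag-n09-w1 g6's `hopen_domAlt_of_windowInterior_of_hsolν` with
   `hwin` DISCHARGED by §2 · ★★★ `hopenCrit_of_hsolν_of_numerics` — the `hopen` binder of p632316 VERBATIM (`T` displayed with its defining clause `hT` as in p633472, all-levels `hsolν`
   as in p632316): `∀ V ∈ domAlt_{j+1}, ∀ c, {z | V c ∈ T c z} ∈ 𝓝 (critCfgOfRecord F N ν K j V)`.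

HONEST FRAMING.  Count-neutral kernel topology BY NAME on landed files (dag-n09-w1 g6's (O), this seat's p631266, dag-n09-w1's `succ_le_range_of_lt` host); NOTHING of Bałaban's
asserted; [B11] solvability `hsolν` and the [B7]-numerics + chart guards stay DISPLAYED hypotheses; NO window ∕ chart of record constructed or re-pointed; (P) and dag-n09-w5's tower
composition remain theirs; `hreg` ∕ N09 NOT discharged; conjunct 1 (Lemma 4) ∕ FLAG №7 untouched; K0⁷ ∕ K1⁹ ∕ K3⁸ NOT closed; counts unmoved (typed 28∕28 · discharged 5∕28); one
finite four-torus programme at fixed `ε = L^{−K}` per run — R4 closes the conditional rung `BalabanLadder.UV` only; NOT ℝ⁴ ∕ infinite volume ∕ OS; the Yang–Mills mass gap (Clay) is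
NOT proved by any of this.
-/

open scoped Topology
open Filter Set Function

namespace Summit.QuantumFields.YangMills.BalabanUVNodes.N09WindowInteriorAtRecord

open Literature.MathematicalPhysics.QuantumFieldTheory.Balaban1983to89
open Literature.MathematicalPhysics.QuantumFieldTheory.Balaban1983to89.T4Continuum (T4Family)
open Literature.MathematicalPhysics.QuantumFieldTheory.Balaban1983to89.BlockAveraging (Idx avgFun loopHol)
open Literature.MathematicalPhysics.QuantumFieldTheory.Balaban1983to89.BlockAveragingHaarAC (centralBond pre post)
open Literature.MathematicalPhysics.QuantumFieldTheory.Balaban1983to89.BlockAveragingEMLHaarAC (fibreFamily loopHol_update_centralBond_self)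
open Literature.MathematicalPhysics.QuantumFieldTheory.Balaban1983to89.ExpMeanLog (expMeanLogSU deltaSU)
open Literature.MathematicalPhysics.QuantumFieldTheory.Balaban1983to89.Node00
open Summit.QuantumFields.YangMills.BalabanUVNodes.N09CentralWindowInverseContinuous (continuous_centralWindowFamily)
open Summit.QuantumFields.YangMills.BalabanUVNodes.N09OneBondParametricOpenness (loopHol_critCfgOfRecord_le hopen_domAlt_of_windowInterior_of_hsolν)
open Summit.QuantumFields.YangMills.BalabanUVNodes.N09LiftInvariance29AtRecord (succ_le_range_of_lt)

variable {P : Params} {j : ℕ} {N : ℕ} [NeZero N]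

/-! ## §1  Strict loop letters put the base point in the interior of the closed α-window graph -/

/-- §1 **INTERIORITY FROM STRICT LOOP LETTERS.**  If the loop letters of `U₀` at the coarse bond `c` are STRICTLY `α`-small, `∀ i, dist1 (loopHol U₀ c i) < α`, then the graph of
the closed `α`-window family `{p | ∀ i, dist1 (fibreFamily p.1 c (pre p.1 c · p.2 · post p.1 c) i) ≤ α}` is a neighbourhood of the base point `(U₀, U₀(β c))`: the letters are
jointly continuous (`continuous_centralWindowFamily`) and equal the loop letters at the base point (`loopHol_update_centralBond_self`), so the strict window is an open
neighbourhood inside the closed one. [cite: Balaban1987RG1, (0.4) p.253 and (2.10) p.267; BourbakiGT1, Ch. I §2 no. 1 Prop. 1 p. 22] -/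
theorem centralWindowGraph_mem_nhds_of_loopHol_lt (hj : j + 1 ≤ P.m + P.K) (U₀ : GaugeField P j (SU N)) (c : PBond P (j + 1)) {α : ℝ}
    (hU₀ : ∀ i : Idx P, dist1 (loopHol U₀ c i) < α) :
    {p : GaugeField P j (SU N) × SU N | ∀ i : Idx P, dist1 (fibreFamily p.1 c (pre p.1 c * p.2 * post p.1 c) i) ≤ α} ∈ 𝓝 (U₀, U₀ (centralBond c)) := by
  have hloop : loopHol U₀ c = fibreFamily U₀ c (pre U₀ c * U₀ (centralBond c) * post U₀ c) := by
    have h := loopHol_update_centralBond_self hj U₀ c (U₀ (centralBond c))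
    rwa [update_eq_self] at h
  have hstrict : ∀ᶠ p : GaugeField P j (SU N) × SU N in 𝓝 (U₀, U₀ (centralBond c)),
      ∀ i : Idx P, dist1 (fibreFamily p.1 c (pre p.1 c * p.2 * post p.1 c) i) < α := by
    refine eventually_all.2 fun i => ?_
    have hc : Continuous fun p : GaugeField P j (SU N) × SU N => dist1 (fibreFamily p.1 c (pre p.1 c * p.2 * post p.1 c) i) :=
      B12ContinuousTransportInvarianceOn.continuous_dist1_SU.comp (continuous_centralWindowFamily c i)
    have h0 : dist1 (fibreFamily U₀ c (pre U₀ c * U₀ (centralBond c) * post U₀ c) i) < α := by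
      rw [← hloop]; exact hU₀ i
    exact (hc.tendsto (U₀, U₀ (centralBond c))).eventually (gt_mem_nhds h0)
  exact hstrict.mono fun p hp i => (hp i).le

/-! ## §2  At the record: the critical configuration is a strict window point under the strict chart guard -/

variable {F : T4Family}

/-- §2 **INTERIORITY AT THE CRITICAL CONFIGURATION.**  On the `K`-th torus, `j < K`: if the level-`(j+1)` problem of `V` is solvable at `ν.εreg` (`UkExists`), the [B7] Prop-2
numerics hold (`0 < εreg`, `C₀·εreg ≤ ⅓`, `2εreg ≤ c′₂`) and the chart guard is STRICT, `(((d+2)L)²∕4)·(2εreg∕L²) < α`, then the closed `α`-window graph at the coarse bond `c` is a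
neighbourhood of `(V^{(j)}(V), V^{(j)}(V)(β c))` — dag-n09-w1 g6's `hwin`, discharged for the window family of record (their `loopHol_critCfgOfRecord_le` + §1).
[cite: Balaban1985Averaging, Prop. 2 (53) p.26; Balaban1987RG1, (2.3)–(2.4) pp.265–266 and (2.10) p.267] -/
theorem centralWindowGraph_mem_nhds_critCfg_of_ukExists (ν : Stage7Numerics) {K : ℕ} (hj : j < K) (hεreg : 0 < ν.εreg)
    (hε3 : (143 * (((((F.P K).d + 4 : ℕ) : ℝ)) ^ 2 / 4) ^ 2) * ν.εreg ≤ 1 / 3)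
    (hε2 : 2 * ν.εreg ≤ 2 * deltaSU (Fin N) / ((((F.P K).d + 4) * (F.P K).L : ℕ) : ℝ) ^ 2) {α : ℝ}
    (hαstrict : ((((F.P K).d + 2) * (F.P K).L : ℕ) : ℝ) ^ 2 / 4 * (2 * ν.εreg / ((F.P K).L : ℝ) ^ 2) < α)
    {V : GaugeField (F.P K) (j + 1) (SU N)} (hV : UkExists F N K (j + 1) ν.εreg V) (c : PBond (F.P K) (j + 1)) :
    {p : GaugeField (F.P K) j (SU N) × SU N | ∀ i : Idx (F.P K), dist1 (fibreFamily p.1 c (pre p.1 c * p.2 * post p.1 c) i) ≤ α} ∈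
      𝓝 (critCfgOfRecord F N ν K j V, critCfgOfRecord F N ν K j V (centralBond c)) :=
  centralWindowGraph_mem_nhds_of_loopHol_lt (succ_le_range_of_lt hj) (critCfgOfRecord F N ν K j V) c
    fun i => (loopHol_critCfgOfRecord_le ν hεreg hε3 hε2 hV c i).trans_lt hαstrict

/-! ## §3  (O) for the closed α-window of record — the `hopen` binder of p632316, supplied -/

/-- §3 ★★★ **(O) FOR THE WINDOW OF RECORD, level-`j` solvability form.**  On the `K`-th torus, `j < K`, with `α ≤ 1∕24`, `α < δ_N`, `157·α < L^{−(d−1)}`, the Prop-2 numerics,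
the STRICT chart guard `(((d+2)L)²∕4)·(2εreg∕L²) < α` and level-`(j+1)` solvability on `domAlt_{j+1}` (`hsol`): for every `V ∈ domAlt_{j+1}` and every coarse bond `c`, the
environments `z` whose closed `α`-window at `c` still averages onto `V c` form a neighbourhood of `V^{(j)}(V)` — dag-n09-w1 g6's `hopen_domAlt_of_windowInterior_of_hsolν` BY NAME
with its window-interiority input `hwin` DISCHARGED by §2.  CONDITIONAL on the displayed hypotheses; nothing of Bałaban's asserted.
[cite: Balaban1987RG1, (0.4) p.253, (2.3)–(2.4) pp.265–266 and (2.10) p.267; Balaban1985Averaging, Prop. 2 (53) p.26 and Prop. 3 (124) p.36; Balaban1985Variational, Thm 1 (8)–(10) p.279] -/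
theorem image_centralWindow_mem_nhds_critCfg_of_ukExists (ν : Stage7Numerics) {K : ℕ} (hj : j < K) {α : ℝ}
    (hα24 : α ≤ 1 / 24) (hαδ : α < deltaSU (Fin N)) (hαL : 157 * α < (((F.P K).L : ℝ) ^ ((F.P K).d - 1))⁻¹)
    (hεreg : 0 < ν.εreg) (hε3 : (143 * (((((F.P K).d + 4 : ℕ) : ℝ)) ^ 2 / 4) ^ 2) * ν.εreg ≤ 1 / 3)
    (hε2 : 2 * ν.εreg ≤ 2 * deltaSU (Fin N) / ((((F.P K).d + 4) * (F.P K).L : ℕ) : ℝ) ^ 2)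
    (hαstrict : ((((F.P K).d + 2) * (F.P K).L : ℕ) : ℝ) ^ 2 / 4 * (2 * ν.εreg / ((F.P K).L : ℝ) ^ 2) < α)
    (hsol : ∀ W ∈ domAltOfRecord F N ν K (j + 1), UkExists F N K (j + 1) ν.εreg W) :
    ∀ V ∈ domAltOfRecord F N ν K (j + 1), ∀ c : PBond (F.P K) (j + 1),
      {z : GaugeField (F.P K) j (SU N) | V c ∈ (fun g => (avOfRecord F N K j).avg (Function.update z (centralBond c) g) c) ''
        {g : SU N | ∀ i : Idx (F.P K), dist1 (fibreFamily z c (pre z c * g * post z c) i) ≤ α}} ∈ 𝓝 (critCfgOfRecord F N ν K j V) :=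
  hopen_domAlt_of_windowInterior_of_hsolν ν hj hα24 hαδ hαL hεreg hε3 hε2 hαstrict.le hsol
    (fun c U => {g : SU N | ∀ i : Idx (F.P K), dist1 (fibreFamily U c (pre U c * g * post U c) i) ≤ α})
    fun V hV c => centralWindowGraph_mem_nhds_critCfg_of_ukExists ν hj hεreg hε3 hε2 hαstrict (hsol V hV) c

/-- §3 ★★★ **THE `hopen` BINDER OF p632316, SUPPLIED** (`…N09TowerBasePointSocketsOfOpenness.tower_hΦc∕hJpos_of_openness_of_hsolν_of_numerics`, window family of record): with
the per-bond image windows `T` displayed through their defining clause `hT` (as in p633472 `exists_perBondCharts_of_forwardLaws_sharp`) and all-levels solvability `hsolν` (as in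
p632316), for `j < K`: `∀ V ∈ domAlt_{j+1}, ∀ c, {z | V c ∈ T c z} ∈ 𝓝 (critCfgOfRecord F N ν K j V)`, under `α ≤ 1∕24`, `α < δ_N`, `157·α < L^{−(d−1)}`, the Prop-2 numerics and
the STRICT chart guard.  CONDITIONAL on the displayed hypotheses; nothing of Bałaban's asserted; N09 NOT discharged by this.
[cite: Balaban1987RG1, (0.4) p.253, (2.3)–(2.4) pp.265–266 and (2.10) p.267; Balaban1985Averaging, Prop. 2 (53) p.26 and Prop. 3 (124) p.36; Balaban1985Variational, Thm 1 (8)–(10) p.279] -/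
theorem hopenCrit_of_hsolν_of_numerics (ν : Stage7Numerics) {K : ℕ} (hj : j < K) {α : ℝ}
    (hα24 : α ≤ 1 / 24) (hαδ : α < deltaSU (Fin N)) (hαL : 157 * α < (((F.P K).L : ℝ) ^ ((F.P K).d - 1))⁻¹)
    (T : PBond (F.P K) (j + 1) → GaugeField (F.P K) j (SU N) → Set (SU N))
    (hT : ∀ c U, T c U = (fun g => (avOfRecord F N K j).avg (Function.update U (centralBond c) g) c) ''
        {g : SU N | ∀ i : Idx (F.P K), dist1 (fibreFamily U c (pre U c * g * post U c) i) ≤ α})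
    (hεreg : 0 < ν.εreg) (hε3 : (143 * (((((F.P K).d + 4 : ℕ) : ℝ)) ^ 2 / 4) ^ 2) * ν.εreg ≤ 1 / 3)
    (hε2 : 2 * ν.εreg ≤ 2 * deltaSU (Fin N) / ((((F.P K).d + 4) * (F.P K).L : ℕ) : ℝ) ^ 2)
    (hαstrict : ((((F.P K).d + 2) * (F.P K).L : ℕ) : ℝ) ^ 2 / 4 * (2 * ν.εreg / ((F.P K).L : ℝ) ^ 2) < α)
    (hsolν : ∀ j < K, ∀ W ∈ domAltOfRecord F N ν K (j + 1), UkExists F N K (j + 1) ν.εreg W) :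
    ∀ V ∈ domAltOfRecord F N ν K (j + 1), ∀ c : PBond (F.P K) (j + 1),
      {z : GaugeField (F.P K) j (SU N) | V c ∈ T c z} ∈ 𝓝 (critCfgOfRecord F N ν K j V) := by
  intro V hV c
  have h := image_centralWindow_mem_nhds_critCfg_of_ukExists ν hj hα24 hαδ hαL hεreg hε3 hε2 hαstrict (hsolν j hj) V hV c
  refine mem_of_superset h fun z hz => ?_
  show V c ∈ T c z
  rw [hT c z]
  exact hz

end Summit.QuantumFields.YangMills.BalabanUVNodes.N09WindowInteriorAtRecord
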